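import Summits.QuantumFields.BalabanUV.Beta.GAN24.DiagramVolumeLimitLegs

/-!
# `BalabanUV.Beta.GAN24.DiagramVolumeLimitOneLoop` — binder row G-an2-4 ∕ (CONV-C), route R7 «TWO CURRENCIES», PART 153: THE DRESSED ONE-LOOP DIAGRAM `Γ₁(Σ_k ⊗ₖ Σ_k)Γ₂ᴴ`
# OF THE EFFECTIVE FORM ON `ℤ^d`, MODULO ONLY THE LEGS.  PART 132 proved (UD)+(SR) for `Γ₁(Σ_k ⊗ₖ Σ_k)Γ₂ᴴ` volume-free for all legs decaying at its cross-distance rate `κ′`; PART 150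
# proved the entry limits of `Γ₁(X ⊗ₖ Y)Γ₂ᴴ` at integer pairs from the legs' window decay and entry limits at integer triples (EL₃); PART 142 ∕ 140 give the volume-free bounds and the
# entry limits of `Σ_k`; PART 140's generic END closes.  The socket for row an1's LOCAL (or decaying) Table-T vertices: two checks on the legs (decay at PART 132's rate, EL₃) put the
# dressed one-loop diagram of the lineage's effective form in the β-cell's `LimitRate` currency on `ℤ^d` (unit b2b-balaban-gan24-p3, gen 55; v1)

NOT IN PRINT; OUR PROOF ([folklore] bookkeeping BY NAME over PART 150 (`tendsto_legs_pair`), PART 142 (`effForm_pair_bounds`, `tdist_eq_tdist_sub_zero`, `l1_windowMap_neg`), PART 140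
(`conv_of_decay_of_tendsto`, `tendsto_effForm_entry`), PART 134 (`exp_distK_le_exp_window`, `distK_unitIdx_symm`), PART 132 (`twoLevelDecayRate_oneLoop_effForm`); [Balaban1987RG1] (1.21)–(1.22)
p. 264 LOCATE the shapes; nothing printed is a hypothesis).
HONEST FRAMING (cell contract, verbatim): «discharging `BetaPertH` makes Bałaban's UV stability UNCONDITIONAL — a real constructive-QFT result; it is NOT the
continuum limit and NOT the Clay problem.»  HONEST DEPENDENCY (verbatim): «continuum YM on T⁴ ⇐ BetaPertH ∧ nine spine estimates (0/9 proved); BetaPertH ⇐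
(D1) ∧ (D4) ∧ CAP+tail; G-an2-4 gates asym, D1 and NE2/3/4.»

WHAT THIS FILE PROVES (0 sorry, 0 `def`; `e = unitIdx⁻¹`, `Σ_k = (Q_k𝒢Q_kᴴ)⁻¹ − a·1` on the unit index set of the cubic torus):
* `exp_distK_le_exp_window_pair'` (PART 132's cross-distance decay ⟹ window decay away from the root, rate `κ′∕d`).
* **`conv_oneLoop_effForm_of_legs`** — THE END (`d ≥ 3`, `L ≥ 2`, `a > 0`, `μ ≠ ν`, even cubic volumes): `∃ κ′ > 0, C, C′ ≥ 0` (PART 132's, from `(d, L, a)`) such that for ALL `γ₁, γ₂ ≥ 0`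
  and ALL volume-indexed legs `Γ₁_t, Γ₂_t : Matrix idx (idx × idx)` with PART 132's decay `‖Γᵢ_t x q‖ ≤ γᵢe^{−κ′(distK x q₁ + distK x q₂)}` and EL₃: `∃ Π` with
  `IsInfiniteVolumeLimit evenPeriod (Re (Γ₁_t(Σ_k ⊗ₖ Σ_k)Γ₂_tᴴ)(e(·,μ′),e(0,ν′))) (Π k)`, `UniformDecay Π μ ν (γ₁γ₂C) ((κ′∕4)∕d)`, `StepRate Π μ ν (γ₁γ₂C′) ((κ′∕4)∕d) (√(L⁻¹))`, `KernelInputs d Π`,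
  `|secondMoment (Π k) μ ν − secondMoment Π_∞ μ ν| ≤ β′_d(γ₁γ₂C′∕(1−√(L⁻¹)), (κ′∕4)∕d)·(√(L⁻¹))^k`.
WHAT IT DOES NOT DO: say which legs Bałaban's `Π⁰_{k+1}` has (row an1's Table-T dictionary); level-dependent legs; `d ≤ 2` ∕ odd volumes.  SUPPLIER work; NEVER «G-an2-4 closed»;
NOT (CONV-C), NOT D1, NOT `BetaPertH`, NOT continuum, NOT Clay.  Records: `HOME/b2b-balaban-gan24-p3/gen55/README.md`.
-/

noncomputable section

open scoped BigOperators ComplexConjugate Matrix Matrix.Norms.L2Operator Kronecker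
open Filter Topology

namespace Summit.QuantumFields.BalabanUV.Beta.GAN24.DiagramVolumeLimitOneLoop

open Literature.MathematicalPhysics.QuantumFieldTheory.Balaban1983to89
open Literature.MathematicalPhysics.QuantumFieldTheory.Balaban1983to89.B12Sec2to5 (l1 betaPrime510)
open Literature.MathematicalPhysics.QuantumFieldTheory.Balaban1983to89.Beta (Site windowMap IsInfiniteVolumeLimit)
open Literature.MathematicalPhysics.QuantumFieldTheory.Balaban1983to89.Beta.FreeLegDictionary (cubic)
open Literature.MathematicalPhysics.QuantumFieldTheory.Balaban1983to89.Beta.BlockKernelVolumeSockets (evenPeriod tendsto_evenPeriod)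
open Literature.MathematicalPhysics.QuantumFieldTheory.Balaban1983to89.Beta.VectorTails (castT)
open Literature.MathematicalPhysics.QuantumFieldTheory.Balaban1983to89.Beta.LimitRate (StepRate limKernelOf KernelInputs)
open Summit.QuantumFields.BalabanUV.T4Continuum
open Summit.QuantumFields.BalabanUV.T4Continuum.BalabanAveragedTowerUnit (idx unitCovB)
open Summit.QuantumFields.BalabanUV.T4Continuum.BalabanAveragedCoerciveTower (unitIdx)
open Summit.QuantumFields.BalabanUV.T4Continuum.CTKingTowerWeights (distK)
open Summit.QuantumFields.BalabanUV.T4Continuum.DecayRateInterpolation (EntryDecay TwoLevelDecayRate)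
open Summit.QuantumFields.BalabanUV.Beta.GAN24.DiagramDecayTorus (twoLevelDecayRate_oneLoop_effForm)
open Summit.QuantumFields.BalabanUV.Beta.GAN24.DiagramDecayWindow (exp_distK_le_exp_window distK_unitIdx_symm)
open Summit.QuantumFields.BalabanUV.Beta.GAN24.DiagramVolumeLimit (conv_of_decay_of_tendsto tendsto_effForm_entry)
open Summit.QuantumFields.BalabanUV.Beta.GAN24.DiagramVolumeLimitPairs (l1_windowMap_neg tdist_eq_tdist_sub_zero effForm_pair_bounds)
open Summit.QuantumFields.BalabanUV.Beta.GAN24.DiagramVolumeLimitLegs (tendsto_legs_pair)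

variable {d : ℕ} (L : ℕ) [NeZero L]

/-! ## §4 THE END for the dressed one-loop diagram of the effective form -/

/-- PART 132's cross-distance decay ⟹ window decay away from the root, rate `κ′∕d`: `e^{−κ′·distK(e(x,μ), e(u,λ))} ≤ e^{−(κ′∕d)|windowMap(u − x)|₁}` (`κ′ ≥ 0`). [folklore] -/
theorem exp_distK_le_exp_window_pair' (s : ℕ) [NeZero s] {κ' : ℝ} (hκ' : 0 ≤ κ') (x : Site d s) (μ : Fin d) (u : Site d s) (l : Fin d) :
    Real.exp (-(κ' * distK L (cubic d s) ((unitIdx L (cubic d s)).symm (x, μ)) ((unitIdx L (cubic d s)).symm (u, l)))) ≤ Real.exp (-(κ' / d) * l1 (windowMap d s (u - x))) := by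
  have hdist : distK L (cubic d s) ((unitIdx L (cubic d s)).symm (x, μ)) ((unitIdx L (cubic d s)).symm (u, l))
      = distK L (cubic d s) ((unitIdx L (cubic d s)).symm (x - u, μ)) ((unitIdx L (cubic d s)).symm (0, l)) := by
    rw [distK_unitIdx_symm, distK_unitIdx_symm, tdist_eq_tdist_sub_zero]
  rw [hdist, show u - x = -(x - u) from (neg_sub x u).symm, l1_windowMap_neg]
  exact exp_distK_le_exp_window L s hκ' (x - u) μ l

variable (a : ℝ) (ha : 0 < a)

/-- **`conv_oneLoop_effForm_of_legs` — THE DRESSED ONE-LOOP DIAGRAM `Γ₁(Σ_k ⊗ Σ_k)Γ₂ᴴ` ON `ℤ^d`, MODULO ONLY THE LEGS** [our proof] (`d ≥ 3`, `L ≥ 2`, `a > 0`, `μ ≠ ν`, along the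
even cubic volumes `side t = 2(t+1)`; `Σ_k = (Q_k𝒢Q_kᴴ)⁻¹ − a·1`): there are `κ′ > 0`, `C, C′ ≥ 0` (PART 132's, from `(d, L, a)`) such that for ALL `γ₁, γ₂ ≥ 0` and ALL volume-indexed legs
`Γ₁_t, Γ₂_t : Matrix idx (idx × idx)` with PART 132's decay `‖Γᵢ_t x q‖ ≤ γᵢ·e^{−κ′(distK x q₁ + distK x q₂)}` on every volume and EL₃ (entries at integer triples converge): limit kernels `Π_k`
with `IsInfiniteVolumeLimit evenPeriod (Re (Γ₁_t(Σ_k ⊗ₖ Σ_k)Γ₂_tᴴ)(e(·,μ′), e(0,ν′))) (Π k)` for all `k`, `UniformDecay Π μ ν (γ₁γ₂C) ((κ′∕4)∕d)`, `StepRate Π μ ν (γ₁γ₂C′) ((κ′∕4)∕d) (√(L⁻¹))`,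
`KernelInputs d Π` inhabited, `∀ k, |secondMoment (Π k) μ ν − secondMoment (limKernelOf Π) μ ν| ≤ β′_d(γ₁γ₂C′∕(1−√(L⁻¹)), (κ′∕4)∕d)·(√(L⁻¹))^k` — PART 132's (UD)+(SR), §3's EL₂ (with PART
142's volume-free bounds on `Σ_k` and PART 140's `tendsto_effForm_entry`), PART 140's generic END. [cite: Balaban1987RG1, (1.21)–(1.22) p.264 (shapes)] -/
theorem conv_oneLoop_effForm_of_legs (hL : 2 ≤ L) (hd : 3 ≤ d) {μ ν : Fin d} (hne : μ ≠ ν) :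
    ∃ κ' C C' : ℝ, 0 < κ' ∧ 0 ≤ C ∧ 0 ≤ C' ∧ ∀ (γ₁ γ₂ : ℝ), 0 ≤ γ₁ → 0 ≤ γ₂ →
      ∀ (Γ₁ Γ₂ : (t : ℕ) → Matrix (idx L (cubic d (evenPeriod t)) 0) (idx L (cubic d (evenPeriod t)) 0 × idx L (cubic d (evenPeriod t)) 0) ℂ),
      (∀ t x q, ‖Γ₁ t x q‖ ≤ γ₁ * Real.exp (-(κ' * (distK L (cubic d (evenPeriod t)) x q.1 + distK L (cubic d (evenPeriod t)) x q.2)))) →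
      (∀ t x q, ‖Γ₂ t x q‖ ≤ γ₂ * Real.exp (-(κ' * (distK L (cubic d (evenPeriod t)) x q.1 + distK L (cubic d (evenPeriod t)) x q.2)))) →
      (∀ (μ' l l' : Fin d) (z u v : Fin d → ℤ), ∃ s' : ℂ, Tendsto (fun t => Γ₁ t ((unitIdx L (cubic d (evenPeriod t))).symm (castT (cubic d (evenPeriod t)) z, μ'))
        ((unitIdx L (cubic d (evenPeriod t))).symm (castT (cubic d (evenPeriod t)) u, l), (unitIdx L (cubic d (evenPeriod t))).symm (castT (cubic d (evenPeriod t)) v, l')))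
        atTop (𝓝 s')) →
      (∀ (μ' l l' : Fin d) (z u v : Fin d → ℤ), ∃ s' : ℂ, Tendsto (fun t => Γ₂ t ((unitIdx L (cubic d (evenPeriod t))).symm (castT (cubic d (evenPeriod t)) z, μ'))
        ((unitIdx L (cubic d (evenPeriod t))).symm (castT (cubic d (evenPeriod t)) u, l), (unitIdx L (cubic d (evenPeriod t))).symm (castT (cubic d (evenPeriod t)) v, l')))
        atTop (𝓝 s')) →
      ∃ Pinf : ℕ → B12Beta.Kernel d,
        (∀ k, IsInfiniteVolumeLimit evenPeriod
          (fun t μ' ν' (z : Site d (evenPeriod t)) =>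
            ((Γ₁ t * (((unitCovB L (cubic d (evenPeriod t)) a ha k)⁻¹ - (a : ℂ) • (1 : Matrix (idx L (cubic d (evenPeriod t)) 0) (idx L (cubic d (evenPeriod t)) 0) ℂ)) ⊗ₖ
                ((unitCovB L (cubic d (evenPeriod t)) a ha k)⁻¹ - (a : ℂ) • (1 : Matrix (idx L (cubic d (evenPeriod t)) 0) (idx L (cubic d (evenPeriod t)) 0) ℂ))) * (Γ₂ t)ᴴ)
              ((unitIdx L (cubic d (evenPeriod t))).symm (z, μ')) ((unitIdx L (cubic d (evenPeriod t))).symm (0, ν'))).re) (Pinf k)) ∧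
        Beta.LimitRate.UniformDecay Pinf μ ν (γ₁ * γ₂ * C) ((κ' / 4) / d) ∧ StepRate Pinf μ ν (γ₁ * γ₂ * C') ((κ' / 4) / d) (Real.sqrt ((L : ℝ)⁻¹)) ∧
        (∃ K : KernelInputs d Pinf, K.θ = Real.sqrt ((L : ℝ)⁻¹) ∧ K.c₀ = betaPrime510 d ((γ₁ * γ₂ * C') / (1 - Real.sqrt ((L : ℝ)⁻¹))) ((κ' / 4) / d) ∧
          K.Pinf = limKernelOf Pinf ∧ K.μ = μ ∧ K.ν = ν) ∧
        (∀ k, |B12Beta.secondMoment (Pinf k) μ ν - B12Beta.secondMoment (limKernelOf Pinf) μ ν|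
            ≤ betaPrime510 d ((γ₁ * γ₂ * C') / (1 - Real.sqrt ((L : ℝ)⁻¹))) ((κ' / 4) / d) * Real.sqrt ((L : ℝ)⁻¹) ^ k) := by
  have hd1 : 1 ≤ d := le_trans (by norm_num) hd
  have hd2 : 2 ≤ d := le_trans (by norm_num) hd
  have hd0 : (0 : ℝ) < d := by exact_mod_cast lt_of_lt_of_le zero_lt_one hd1
  have hL1 : (1 : ℝ) < L := by exact_mod_cast (lt_of_lt_of_le one_lt_two hL : 1 < L)
  have hθ0 : 0 ≤ Real.sqrt ((L : ℝ)⁻¹) := Real.sqrt_nonneg _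
  have hθ1 : Real.sqrt ((L : ℝ)⁻¹) < 1 := by
    rw [show (1 : ℝ) = Real.sqrt 1 from Real.sqrt_one.symm]
    exact Real.sqrt_lt_sqrt (inv_nonneg.mpr (Nat.cast_nonneg _)) (inv_lt_one_of_one_lt₀ hL1)
  obtain ⟨κ', C, C', hκ', hC, hC', h132⟩ := twoLevelDecayRate_oneLoop_effForm L a ha hL hd2
  obtain ⟨κs, Bs, hκs, hBs, hSig⟩ := effForm_pair_bounds L a ha hL hd2
  refine ⟨κ', C, C', hκ', hC, hC', fun γ₁ γ₂ hγ₁ hγ₂ Γ₁ Γ₂ hΓ₁ hΓ₂ hΓ₁el hΓ₂el => ?_⟩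
  -- (UD)+(SR) from PART 132, on every volume
  have hud : ∀ t k, EntryDecay (distK L (cubic d (evenPeriod t)))
      (Γ₁ t * (((unitCovB L (cubic d (evenPeriod t)) a ha k)⁻¹ - (a : ℂ) • (1 : Matrix (idx L (cubic d (evenPeriod t)) 0) (idx L (cubic d (evenPeriod t)) 0) ℂ)) ⊗ₖ
        ((unitCovB L (cubic d (evenPeriod t)) a ha k)⁻¹ - (a : ℂ) • (1 : Matrix (idx L (cubic d (evenPeriod t)) 0) (idx L (cubic d (evenPeriod t)) 0) ℂ))) * (Γ₂ t)ᴴ)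
      (γ₁ * γ₂ * C) (κ' / 4) := fun t => (h132 (cubic d (evenPeriod t)) γ₁ γ₂ hγ₁ hγ₂ (Γ₁ t) (Γ₂ t) (hΓ₁ t) (hΓ₂ t)).1
  have hsr : ∀ t, TwoLevelDecayRate (distK L (cubic d (evenPeriod t)))
      (fun k => Γ₁ t * (((unitCovB L (cubic d (evenPeriod t)) a ha k)⁻¹ - (a : ℂ) • (1 : Matrix (idx L (cubic d (evenPeriod t)) 0) (idx L (cubic d (evenPeriod t)) 0) ℂ)) ⊗ₖ
        ((unitCovB L (cubic d (evenPeriod t)) a ha k)⁻¹ - (a : ℂ) • (1 : Matrix (idx L (cubic d (evenPeriod t)) 0) (idx L (cubic d (evenPeriod t)) 0) ℂ))) * (Γ₂ t)ᴴ)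
      (γ₁ * γ₂ * C') (κ' / 4) (Real.sqrt ((L : ℝ)⁻¹)) := fun t => (h132 (cubic d (evenPeriod t)) γ₁ γ₂ hγ₁ hγ₂ (Γ₁ t) (Γ₂ t) (hΓ₁ t) (hΓ₂ t)).2
  -- the legs' window decay away from the root, rate `κ'/d`
  have hwin : ∀ {γ : ℝ} (Γ : (t : ℕ) → Matrix (idx L (cubic d (evenPeriod t)) 0) (idx L (cubic d (evenPeriod t)) 0 × idx L (cubic d (evenPeriod t)) 0) ℂ),
      (∀ t x q, ‖Γ t x q‖ ≤ γ * Real.exp (-(κ' * (distK L (cubic d (evenPeriod t)) x q.1 + distK L (cubic d (evenPeriod t)) x q.2)))) → 0 ≤ γ →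
      ∀ t (x : Site d (evenPeriod t)) (μ' : Fin d) (u : Site d (evenPeriod t)) (l : Fin d) (v : Site d (evenPeriod t)) (l' : Fin d),
        ‖Γ t ((unitIdx L (cubic d (evenPeriod t))).symm (x, μ')) ((unitIdx L (cubic d (evenPeriod t))).symm (u, l), (unitIdx L (cubic d (evenPeriod t))).symm (v, l'))‖
          ≤ γ * (Real.exp (-(κ' / d) * l1 (windowMap d (evenPeriod t) (u - x))) * Real.exp (-(κ' / d) * l1 (windowMap d (evenPeriod t) (v - x)))) := by
    intro γ Γ hΓ hγ t x μ' u l v l'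
    refine (hΓ t _ _).trans ?_
    rw [mul_add, neg_add, Real.exp_add]
    exact mul_le_mul_of_nonneg_left (mul_le_mul (exp_distK_le_exp_window_pair' L (evenPeriod t) hκ'.le x μ' u l)
      (exp_distK_le_exp_window_pair' L (evenPeriod t) hκ'.le x μ' v l') (Real.exp_pos _).le (Real.exp_pos _).le) hγ
  -- the entry limits: §3 with PART 142's bounds on `Σ_k` and PART 140's `tendsto_effForm_entry`
  refine conv_of_decay_of_tendsto L hd1 tendsto_evenPeriod (by positivity : 0 < κ' / 4) hθ0 hθ1 hud hsr ?_ hne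
  intro k μ' ν' z
  have e0 : ∀ t, castT (cubic d (evenPeriod t)) (0 : Fin d → ℤ) = 0 := fun t => by funext i; simp [castT]
  have hXb : ∀ t (i j : idx L (cubic d (evenPeriod t)) 0),
      ‖((unitCovB L (cubic d (evenPeriod t)) a ha k)⁻¹ - (a : ℂ) • (1 : Matrix (idx L (cubic d (evenPeriod t)) 0) (idx L (cubic d (evenPeriod t)) 0) ℂ)) i j‖ ≤ Bs := by
    intro t i j
    obtain ⟨⟨w, l⟩, hw⟩ := (unitIdx L (cubic d (evenPeriod t))).symm.surjective i
    obtain ⟨⟨y, l'⟩, hy⟩ := (unitIdx L (cubic d (evenPeriod t))).symm.surjective j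
    rw [← hw, ← hy]
    exact (hSig (evenPeriod t) k w l y l').1
  obtain ⟨s', hs'⟩ := tendsto_legs_pair L (side := evenPeriod) tendsto_evenPeriod hBs hXb hXb (hwin Γ₁ hΓ₁ hγ₁) (hwin Γ₂ hΓ₂ hγ₂) (div_pos hκ' hd0)
    (fun μ₁ ν₁ w w' => tendsto_effForm_entry L a ha hd k μ₁ ν₁ w w') (fun μ₁ ν₁ w w' => tendsto_effForm_entry L a ha hd k μ₁ ν₁ w w') hΓ₁el hΓ₂el μ' ν' z 0
  refine ⟨s', hs'.congr fun t => ?_⟩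
  rw [e0]

end Summit.QuantumFields.BalabanUV.Beta.GAN24.DiagramVolumeLimitOneLoop

end
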